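import Literature.Computability.Cryptography.LWENoiseWidth
import Mathlib.MeasureTheory.Group.Convolution
import HarnessLib

/-!
# Adding independent Gaussian noise: `Ψ_β ∗ Ψ_γ = Ψ_{√(β²+γ²)}` (Regev 2009, Lemma 3.7; BLPRS 2013, Lemma 2.15)

Topic `Computability/Cryptography` (LWE noise), grouping namespace `LWE`; sequel of `LWENoiseWidth.lean`
(`widthVar a = a²/(2π)`, the variance parameter of the real Gaussian of width `a` behind
`wrappedGaussian a = Ψ_a`). Proved material (no named fact) towards pqc.S19–S21: the exact-law step of
the noise-rate normalisations (Regev 2009, Lemma 3.7: *"adds to the second element of each sample a noise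
sampled independently from `Ψ_{√γ}`. This creates `nᶜ` samples taken from the distribution
`A_{s,Ψ_{√(β²+γ)}}`"*; BLPRS 2013, Lemma 2.15; also the "trivial reduction from `LWE_{k,m,q,α}` to
`LWE_{k+1,m,q,√(5n)α}`" of BLPRS Thm. 4.1, which raises the noise rate by adding Gaussian noise):
the sum of independent centred Gaussians of widths `β, γ` is a centred Gaussian of width `√(β² + γ²)`
(variances `β²/(2π) + γ²/(2π)`), on `ℝ` (Mathlib's `gaussianReal_conv_gaussianReal`) and, pushing forward
along the quotient homomorphism `ℝ → 𝕋 = ℝ/ℤ`, on the torus.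

## Results

* `widthVar_sqrt_sq_add_sq` — `widthVar √(β²+γ²) = widthVar β + widthVar γ`;
* `gaussianReal_width_conv` — `D_β ∗ D_γ = D_{√(β²+γ²)}` for the real Gaussians `gaussianReal 0 (widthVar ·)`;
* **`wrappedGaussian_conv`** — `Ψ_β ∗ Ψ_γ = Ψ_{√(β²+γ²)}` (`Measure.map_conv_addMonoidHom` along `ℝ →+ 𝕋`);
* `map_add_wrappedGaussian_eq` — the same in random-variable form: for independent `X ∼ Ψ_β`, `Y ∼ Ψ_γ` on a
  probability space, `X + Y ∼ Ψ_{√(β²+γ²)}`.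

## References

* O. Regev, *On lattices, learning with errors, random linear codes, and cryptography*, J. ACM 56 (2009),
  art. 34, proof of Lemma 3.7 (held: arXiv:2401.03703, p. 17).
* Z. Brakerski, A. Langlois, C. Peikert, O. Regev, D. Stehlé, *Classical hardness of learning with errors*,
  STOC 2013, Lemma 2.15 and proof of Thm. 4.1 (arXiv:1306.0281).
-/

noncomputable section

open MeasureTheory ProbabilityTheory
open scoped NNReal

namespace Literature.Computability.Cryptography

namespace LWE

/-- Variance parameters add under `√(β² + γ²)`: `(β² + γ²)/(2π) = β²/(2π) + γ²/(2π)`. [folklore] -/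
theorem widthVar_sqrt_sq_add_sq (β γ : ℝ) :
    widthVar (Real.sqrt (β ^ 2 + γ ^ 2)) = widthVar β + widthVar γ := by
  apply NNReal.coe_injective
  rw [NNReal.coe_add, coe_widthVar, coe_widthVar, coe_widthVar, Real.sq_sqrt (by positivity)]
  ring

/-- **Sum of independent real Gaussians of widths `β`, `γ`** (convolution form): `D_β ∗ D_γ = D_{√(β²+γ²)}`
for `D_a = gaussianReal 0 (a²/(2π))` (Mathlib: `gaussianReal_conv_gaussianReal`). [cite: RegevLWE2009, Lemma 3.7 (proof)] -/
theorem gaussianReal_width_conv (β γ : ℝ) :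
    gaussianReal 0 (widthVar β) ∗ gaussianReal 0 (widthVar γ) =
      gaussianReal 0 (widthVar (Real.sqrt (β ^ 2 + γ ^ 2))) := by
  rw [gaussianReal_conv_gaussianReal, add_zero, widthVar_sqrt_sq_add_sq]

/-- The quotient map `ℝ → 𝕋` as an additive monoid homomorphism is the coercion used by
`wrappedGaussian`. [folklore] -/
theorem coe_quotientMk'_unitAddCircle :
    ⇑(QuotientAddGroup.mk' (AddSubgroup.zmultiples (1 : ℝ))) = fun x : ℝ => (x : UnitAddCircle) := rfl

/-- **`Ψ_β ∗ Ψ_γ = Ψ_{√(β²+γ²)}`**: adding an independent `Ψ_γ` noise to a `Ψ_β`-distributed torus element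
gives a `Ψ_{√(β²+γ²)}`-distributed one ("This creates … samples taken from the distribution
`A_{s,Ψ_{√(β²+γ)}}`"): push the real identity forward along the homomorphism `ℝ →+ 𝕋`, under which
convolution is preserved (`Measure.map_conv_addMonoidHom`). [cite: RegevLWE2009, Lemma 3.7 (proof)] -/
theorem wrappedGaussian_conv (β γ : ℝ) :
    wrappedGaussian β ∗ wrappedGaussian γ = wrappedGaussian (Real.sqrt (β ^ 2 + γ ^ 2)) := by
  have hmeas : Measurable (QuotientAddGroup.mk' (AddSubgroup.zmultiples (1 : ℝ))) := by
    rw [coe_quotientMk'_unitAddCircle]; exact measurable_coe_unitAddCircle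
  have h := Measure.map_conv_addMonoidHom (μ := gaussianReal 0 (widthVar β))
    (ν := gaussianReal 0 (widthVar γ)) (QuotientAddGroup.mk' (AddSubgroup.zmultiples (1 : ℝ))) hmeas
  rw [gaussianReal_width_conv, coe_quotientMk'_unitAddCircle] at h
  exact h.symm

/-- **Random-variable form**: if `X ∼ Ψ_β` and `Y ∼ Ψ_γ` are independent torus-valued random variables on a
probability space, then `X + Y ∼ Ψ_{√(β²+γ²)}`. [cite: RegevLWE2009, Lemma 3.7 (proof)] -/
theorem map_add_wrappedGaussian_eq {Ω : Type*} {mΩ : MeasurableSpace Ω} {P : Measure Ω}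
    [IsProbabilityMeasure P] {β γ : ℝ} {X Y : Ω → UnitAddCircle} (hX : AEMeasurable X P)
    (hY : AEMeasurable Y P) (hXY : IndepFun X Y P) (hXlaw : P.map X = wrappedGaussian β)
    (hYlaw : P.map Y = wrappedGaussian γ) :
    P.map (X + Y) = wrappedGaussian (Real.sqrt (β ^ 2 + γ ^ 2)) := by
  rw [hXY.map_add_eq_map_conv_map₀ hX hY, hXlaw, hYlaw, wrappedGaussian_conv]

end LWE

end Literature.Computability.Cryptography

end
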